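import Summits.NavierStokesRegularity.NavierStokesRegularity.Theses.ScaledTopAlignment
import Summits.NavierStokesRegularity.NavierStokesRegularity.Theorems.ScaledTopAlignmentExistsAnchorGlueKit
import Summits.NavierStokesRegularity.NavierStokesRegularity.Theorems.ScaledTopAlignmentMostTimesHardCoreMeet
import Summits.NavierStokesRegularity.NavierStokesRegularity.Theorems.ScaledTopAlignmentMostTimesRegularCase
import HarnessLib

/-!
# Route `ScaledTopAlignment`: the RE-ANCHORED most-times door W3ᵐᵗ-∃e — rung from the door of record BY NAME,
# regular case, Type-I kill, hard-core location, and the certified glue one-liner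
# (support for the deciding crux `AprioriMostTimesBulkAlignment`, stmt-NavierStokesRegularity-19551)

The planner's banked door W3ᵐᵗ-∃e (cell rev21/: `AprioriMostTimesBulkAlignmentExistsAnchor` = stmt-19551 verbatim
except that the misaligned bulk of a rate-near-max window is measured against SOME unit vector `e = e(t,x)` instead
of `ξ(t,x) = ω(t,x)/|ω(t,x)|`; T2 gen 6 kit inspection / J addendum 1) now has its Theses-free bridge
(`ScaledTopAlignmentExistsAnchorGlueKit`). This file places it, BY NAME, exactly as the door of record is placed:

* `mostTimesBulkAlignedExistsAnchorAt_of_mostTimesBulkAlignedAt` / `aprioriMostTimesBulkAlignmentExistsAnchor_of_aprioriMostTimesBulkAlignment`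
  — DOMINANCE: the W3ᵐᵗ clause at `u` implies the ∃e clause at `u` (anchor `e := ξ(t,x)`, a unit vector since
  `M ≤ |ω(t,x)|`, `M > 0`); hence 19551 ⇒ W3ᵐᵗ-∃e (the planner's `existsAnchor_of_mostTimes`, Summits-side);
* `mostTimesBulkAlignedExistsAnchorAt_of_hasSmoothExtensionPast` — REGULAR CASE: a solution that extends
  classically past `T` satisfies the ∃e clause (through `mostTimesBulkAlignedAt_of_hasSmoothExtensionPast`);
* `hasSmoothExtensionPast_of_mostTimesBulkAlignedExistsAnchorAt_of_typeI` — KILL: the ∃e clause at a solution with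
  the Type-I rate forces extension past `T` (`false_of_mostTimesBulkAlignedExistsAnchor_typeI` + slab bound);
* `existsAnchorDoor_doorCalculus` — LOCATION by ns-sta-19551-p1 g0's door calculus
  (`door_iff_target_of_kill_of_regular`): the Type-I case of W3ᵐᵗ-∃e ↔ `ThreadingFlux.Target` (stmt-1217)
  unconditionally, and `NoTypeII → (W3ᵐᵗ-∃e ↔ Target)`; `threadingFluxTarget_of_aprioriMostTimesBulkAlignmentExistsAnchor`
  (W3ᵐᵗ-∃e ⇒ 1217);
* `navierStokesRegularity_of_existsAnchorDoor_of_noTypeII` — the CERTIFIED GLUE ONE-LINER with the route's own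
  `NoTypeII` decl: «W3ᵐᵗ-∃e → ScaledTopAlignment.NoTypeII → NavierStokesRegularity» (what a re-anchored `closes`
  would be, modulo replacing the written-out door by the new route decl).

Implications between OPEN statements; nothing here proves any door. WHAT THIS IS NOT: not NS regularity.
hard core evaded: NO (≡ Target modulo NoTypeII, like every member of the alignment-door family).
-/

noncomputable section

-- the summit and its single sub-problem share the name (CONVENTIONS §1), as in every Theorems file
set_option linter.dupNamespace false

open MeasureTheory Set Filter Topology
open Literature.Analysis Literature.Analysis.FluidPDE

namespace Summit.NavierStokesRegularity.NavierStokesRegularity.Theorems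

/-! ### Dominance: the door of record implies the re-anchored door -/

/-- **At one vorticity family: the W3ᵐᵗ clause implies the ∃e clause** (anchor `e := ξ(t,x) = ‖ω(t,x)‖⁻¹ ω(t,x)`,
a unit vector because `0 < M ≤ ‖ω(t,x)‖`). Abstract over `ω`. [folklore] -/
theorem mostTimesBulkAlignedExistsAnchorAt_of_mostTimesBulkAlignedAt {ν T : ℝ}
    {ω : ℝ → EuclideanSpace ℝ (Fin 3) → EuclideanSpace ℝ (Fin 3)}
    (h : ∃ lam0 : ℝ, lam0 < 1 ∧ ∃ R0 : ℝ, 0 < R0 ∧ ∃ θ : ℝ, θ < 1 ∧ ∀ κ : ℝ, 0 < κ → ∀ ε : ℝ, 0 < ε →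
      ∀ δ : ℝ, 0 < δ → ∃ M : ℝ, 0 < M ∧ ∃ E : Set ℝ,
        (∃ h0 : ℝ, 0 < h0 ∧ ∀ h : ℝ, 0 < h → h < h0 →
          volume (E ∩ Set.Ioo (T - h) T) ≤ ENNReal.ofReal (θ * h)) ∧
        ∀ t ∈ Set.Ico 0 T, t ∉ E → ∀ x : EuclideanSpace ℝ (Fin 3), M ≤ ‖ω t x‖ → κ / (T - t) ≤ ‖ω t x‖ →
          volume {y : EuclideanSpace ℝ (Fin 3) | lam0 * ‖ω t x‖ ≤ ‖ω t y‖ ∧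
              ‖x - y‖ ≤ R0 * Real.sqrt (ν / ‖ω t x‖) ∧
              ε < Real.sqrt (1 - (inner ℝ (‖ω t x‖⁻¹ • ω t x) (‖ω t y‖⁻¹ • ω t y)) ^ 2)}
            ≤ ENNReal.ofReal (δ * Real.sqrt (ν / ‖ω t x‖) ^ 3)) :
    ∃ lam0 : ℝ, lam0 < 1 ∧ ∃ R0 : ℝ, 0 < R0 ∧ ∃ θ : ℝ, θ < 1 ∧ ∀ κ : ℝ, 0 < κ → ∀ ε : ℝ, 0 < ε →
      ∀ δ : ℝ, 0 < δ → ∃ M : ℝ, 0 < M ∧ ∃ E : Set ℝ,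
        (∃ h0 : ℝ, 0 < h0 ∧ ∀ h : ℝ, 0 < h → h < h0 →
          volume (E ∩ Set.Ioo (T - h) T) ≤ ENNReal.ofReal (θ * h)) ∧
        ∀ t ∈ Set.Ico 0 T, t ∉ E → ∀ x : EuclideanSpace ℝ (Fin 3), M ≤ ‖ω t x‖ → κ / (T - t) ≤ ‖ω t x‖ →
          ∃ e : EuclideanSpace ℝ (Fin 3), ‖e‖ = 1 ∧
            volume {y : EuclideanSpace ℝ (Fin 3) | lam0 * ‖ω t x‖ ≤ ‖ω t y‖ ∧
                ‖x - y‖ ≤ R0 * Real.sqrt (ν / ‖ω t x‖) ∧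
                ε < Real.sqrt (1 - (inner ℝ e (‖ω t y‖⁻¹ • ω t y)) ^ 2)}
              ≤ ENNReal.ofReal (δ * Real.sqrt (ν / ‖ω t x‖) ^ 3) := by
  -- adapted from the planner's `NsregP3.R21.existsAnchor_of_mostTimes` (cell rev21/W3mtExistsAnchor.lean)
  obtain ⟨lam0, hlam0, R0, hR0, θ, hθ, hfam⟩ := h
  refine ⟨lam0, hlam0, R0, hR0, θ, hθ, fun κ hκ ε hε δ hδ => ?_⟩
  obtain ⟨M, hM, E, hE, hpt⟩ := hfam κ hκ ε hε δ hδ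
  refine ⟨M, hM, E, hE, fun t ht htE x hMx hκx => ?_⟩
  refine ⟨‖ω t x‖⁻¹ • ω t x, ?_, hpt t ht htE x hMx hκx⟩
  have hne : ‖ω t x‖ ≠ 0 := (hM.trans_le hMx).ne'
  rw [norm_smul, norm_inv, norm_norm, inv_mul_cancel₀ hne]

/-- **19551 ⇒ W3ᵐᵗ-∃e, BY NAME** (the door of record implies the planner's re-anchored door rev21
`AprioriMostTimesBulkAlignmentExistsAnchor`, written out; = `NsregP3.R21.existsAnchor_of_mostTimes`). [folklore] -/
theorem aprioriMostTimesBulkAlignmentExistsAnchor_of_aprioriMostTimesBulkAlignment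
    (hW : Summit.NavierStokesRegularity.NavierStokesRegularity.Theses.ScaledTopAlignment.AprioriMostTimesBulkAlignment) :
    ∀ (ν T : ℝ), 0 < ν → 0 < T → ∀ (u : ℝ → EuclideanSpace ℝ (Fin 3) → EuclideanSpace ℝ (Fin 3))
      (p : ℝ → EuclideanSpace ℝ (Fin 3) → ℝ), IsClassicalNSSolutionOn (Set.Ico 0 T) ν 0 u p →
      IsLerayHopfOn T ν 0 (u 0) u → HasRapidSpatialDecay (u 0) →
      ∃ lam0 : ℝ, lam0 < 1 ∧ ∃ R0 : ℝ, 0 < R0 ∧ ∃ θ : ℝ, θ < 1 ∧ ∀ κ : ℝ, 0 < κ → ∀ ε : ℝ, 0 < ε →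
        ∀ δ : ℝ, 0 < δ → ∃ M : ℝ, 0 < M ∧ ∃ E : Set ℝ,
        (∃ h0 : ℝ, 0 < h0 ∧ ∀ h : ℝ, 0 < h → h < h0 →
          MeasureTheory.volume (E ∩ Set.Ioo (T - h) T) ≤ ENNReal.ofReal (θ * h)) ∧
        ∀ t ∈ Set.Ico 0 T, t ∉ E → ∀ x : EuclideanSpace ℝ (Fin 3), M ≤ ‖curl (u t) x‖ →
          κ / (T - t) ≤ ‖curl (u t) x‖ → ∃ e : EuclideanSpace ℝ (Fin 3), ‖e‖ = 1 ∧
            MeasureTheory.volume {y : EuclideanSpace ℝ (Fin 3) | lam0 * ‖curl (u t) x‖ ≤ ‖curl (u t) y‖ ∧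
                ‖x - y‖ ≤ R0 * Real.sqrt (ν / ‖curl (u t) x‖) ∧
                ε < Real.sqrt (1 - (inner ℝ e (‖curl (u t) y‖⁻¹ • curl (u t) y)) ^ 2)}
              ≤ ENNReal.ofReal (δ * Real.sqrt (ν / ‖curl (u t) x‖) ^ 3) :=
  fun ν T hν hT u p hcl hLH hdec =>
    mostTimesBulkAlignedExistsAnchorAt_of_mostTimesBulkAlignedAt (ω := fun t => curl (u t))
      (hW ν T hν hT u p hcl hLH hdec)

/-! ### Regular case and Type-I kill of the re-anchored door -/

/-- **Regular case of W3ᵐᵗ-∃e.** A classical Leray–Hopf solution from a rapidly decaying datum on `[0,T)` that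
extends classically past `T` satisfies the ∃e clause (`mostTimesBulkAlignedAt_of_hasSmoothExtensionPast`, then
dominance). [folklore] -/
theorem mostTimesBulkAlignedExistsAnchorAt_of_hasSmoothExtensionPast {ν T : ℝ} (hν : 0 < ν) (hT : 0 < T)
    {u : ℝ → EuclideanSpace ℝ (Fin 3) → EuclideanSpace ℝ (Fin 3)} {p : ℝ → EuclideanSpace ℝ (Fin 3) → ℝ}
    (hcl : IsClassicalNSSolutionOn (Ico 0 T) ν 0 u p) (hLH : IsLerayHopfOn T ν 0 (u 0) u)
    (hdec : HasRapidSpatialDecay (u 0)) (hext : HasSmoothExtensionPast ν 0 u T) :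
    ∃ lam0 : ℝ, lam0 < 1 ∧ ∃ R0 : ℝ, 0 < R0 ∧ ∃ θ : ℝ, θ < 1 ∧ ∀ κ : ℝ, 0 < κ → ∀ ε : ℝ, 0 < ε →
      ∀ δ : ℝ, 0 < δ → ∃ M : ℝ, 0 < M ∧ ∃ E : Set ℝ,
        (∃ h0 : ℝ, 0 < h0 ∧ ∀ h : ℝ, 0 < h → h < h0 →
          volume (E ∩ Set.Ioo (T - h) T) ≤ ENNReal.ofReal (θ * h)) ∧
        ∀ t ∈ Set.Ico 0 T, t ∉ E → ∀ x : EuclideanSpace ℝ (Fin 3), M ≤ ‖curl (u t) x‖ →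
          κ / (T - t) ≤ ‖curl (u t) x‖ → ∃ e : EuclideanSpace ℝ (Fin 3), ‖e‖ = 1 ∧
            volume {y : EuclideanSpace ℝ (Fin 3) | lam0 * ‖curl (u t) x‖ ≤ ‖curl (u t) y‖ ∧
                ‖x - y‖ ≤ R0 * Real.sqrt (ν / ‖curl (u t) x‖) ∧
                ε < Real.sqrt (1 - (inner ℝ e (‖curl (u t) y‖⁻¹ • curl (u t) y)) ^ 2)}
              ≤ ENNReal.ofReal (δ * Real.sqrt (ν / ‖curl (u t) x‖) ^ 3) :=
  mostTimesBulkAlignedExistsAnchorAt_of_mostTimesBulkAlignedAt (ω := fun t => curl (u t))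
    (mostTimesBulkAlignedAt_of_hasSmoothExtensionPast hν hT hcl hLH hdec hext)

/-- **Kill: the ∃e clause at a solution with the Type-I rate forces extension past `T`** (criterion; by
`false_of_mostTimesBulkAlignedExistsAnchor_typeI` and the slab bound of a classical Leray–Hopf solution).
[cite: GigaMiura2011, Thm 1.1 with Rmk 1.4 and §2.1] -/
theorem hasSmoothExtensionPast_of_mostTimesBulkAlignedExistsAnchorAt_of_typeI {ν T : ℝ} (hν : 0 < ν) (hT : 0 < T)
    {u : ℝ → EuclideanSpace ℝ (Fin 3) → EuclideanSpace ℝ (Fin 3)} {p : ℝ → EuclideanSpace ℝ (Fin 3) → ℝ}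
    (hcl : IsClassicalNSSolutionOn (Ico 0 T) ν 0 u p) (hLH : IsLerayHopfOn T ν 0 (u 0) u)
    (hdec : HasRapidSpatialDecay (u 0))
    (hW : ∃ lam0 : ℝ, lam0 < 1 ∧ ∃ R0 : ℝ, 0 < R0 ∧ ∃ θ : ℝ, θ < 1 ∧ ∀ κ : ℝ, 0 < κ → ∀ ε : ℝ, 0 < ε →
      ∀ δ : ℝ, 0 < δ → ∃ M : ℝ, 0 < M ∧ ∃ E : Set ℝ,
        (∃ h0 : ℝ, 0 < h0 ∧ ∀ h : ℝ, 0 < h → h < h0 →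
          volume (E ∩ Set.Ioo (T - h) T) ≤ ENNReal.ofReal (θ * h)) ∧
        ∀ t ∈ Set.Ico 0 T, t ∉ E → ∀ x : EuclideanSpace ℝ (Fin 3), M ≤ ‖curl (u t) x‖ →
          κ / (T - t) ≤ ‖curl (u t) x‖ → ∃ e : EuclideanSpace ℝ (Fin 3), ‖e‖ = 1 ∧
            volume {y : EuclideanSpace ℝ (Fin 3) | lam0 * ‖curl (u t) x‖ ≤ ‖curl (u t) y‖ ∧
                ‖x - y‖ ≤ R0 * Real.sqrt (ν / ‖curl (u t) x‖) ∧
                ε < Real.sqrt (1 - (inner ℝ e (‖curl (u t) y‖⁻¹ • curl (u t) y)) ^ 2)}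
              ≤ ENNReal.ofReal (δ * Real.sqrt (ν / ‖curl (u t) x‖) ^ 3))
    (hI : IsTypeIBlowup u T) : HasSmoothExtensionPast ν 0 u T := by
  by_contra hext
  obtain ⟨lam0, hlam01, R0, hR0, θ, hθ, hfam⟩ := hW
  exact false_of_mostTimesBulkAlignedExistsAnchor_typeI hν hT hcl hLH
    (slabBound_of_classical_lerayHopf hν hT hcl hLH hdec) hI hext hlam01 hR0 hθ hfam

/-! ### Hard-core location of the re-anchored door (door calculus) -/

/-- **Door calculus for W3ᵐᵗ-∃e.** Unconditionally, the Type-I case of the re-anchored door («Type-I rate ⇒ ∃e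
clause», for every solution of the class) is EQUIVALENT to `ThreadingFlux.Target` (stmt-1217); and given the
route's residual `NoTypeII`, the full a-priori door W3ᵐᵗ-∃e is EQUIVALENT to Target. Instance of
`door_iff_target_of_kill_of_regular` with the kill and regular case above. [folklore] -/
theorem existsAnchorDoor_doorCalculus :
    ((∀ (ν T : ℝ), 0 < ν → 0 < T → ∀ (u : ℝ → EuclideanSpace ℝ (Fin 3) → EuclideanSpace ℝ (Fin 3))
        (p : ℝ → EuclideanSpace ℝ (Fin 3) → ℝ), IsClassicalNSSolutionOn (Set.Ico 0 T) ν 0 u p →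
        IsLerayHopfOn T ν 0 (u 0) u → HasRapidSpatialDecay (u 0) → IsTypeIBlowup u T →
        ∃ lam0 : ℝ, lam0 < 1 ∧ ∃ R0 : ℝ, 0 < R0 ∧ ∃ θ : ℝ, θ < 1 ∧ ∀ κ : ℝ, 0 < κ → ∀ ε : ℝ, 0 < ε →
          ∀ δ : ℝ, 0 < δ → ∃ M : ℝ, 0 < M ∧ ∃ E : Set ℝ,
          (∃ h0 : ℝ, 0 < h0 ∧ ∀ h : ℝ, 0 < h → h < h0 →
            volume (E ∩ Set.Ioo (T - h) T) ≤ ENNReal.ofReal (θ * h)) ∧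
          ∀ t ∈ Set.Ico 0 T, t ∉ E → ∀ x : EuclideanSpace ℝ (Fin 3), M ≤ ‖curl (u t) x‖ →
            κ / (T - t) ≤ ‖curl (u t) x‖ → ∃ e : EuclideanSpace ℝ (Fin 3), ‖e‖ = 1 ∧
              volume {y : EuclideanSpace ℝ (Fin 3) | lam0 * ‖curl (u t) x‖ ≤ ‖curl (u t) y‖ ∧
                  ‖x - y‖ ≤ R0 * Real.sqrt (ν / ‖curl (u t) x‖) ∧
                  ε < Real.sqrt (1 - (inner ℝ e (‖curl (u t) y‖⁻¹ • curl (u t) y)) ^ 2)}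
                ≤ ENNReal.ofReal (δ * Real.sqrt (ν / ‖curl (u t) x‖) ^ 3)) ↔
      Summit.NavierStokesRegularity.NavierStokesRegularity.Theses.ThreadingFlux.Target) ∧
    (Summit.NavierStokesRegularity.NavierStokesRegularity.Theses.ScaledTopAlignment.NoTypeII →
      ((∀ (ν T : ℝ), 0 < ν → 0 < T → ∀ (u : ℝ → EuclideanSpace ℝ (Fin 3) → EuclideanSpace ℝ (Fin 3))
          (p : ℝ → EuclideanSpace ℝ (Fin 3) → ℝ), IsClassicalNSSolutionOn (Set.Ico 0 T) ν 0 u p →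
          IsLerayHopfOn T ν 0 (u 0) u → HasRapidSpatialDecay (u 0) →
          ∃ lam0 : ℝ, lam0 < 1 ∧ ∃ R0 : ℝ, 0 < R0 ∧ ∃ θ : ℝ, θ < 1 ∧ ∀ κ : ℝ, 0 < κ → ∀ ε : ℝ, 0 < ε →
            ∀ δ : ℝ, 0 < δ → ∃ M : ℝ, 0 < M ∧ ∃ E : Set ℝ,
            (∃ h0 : ℝ, 0 < h0 ∧ ∀ h : ℝ, 0 < h → h < h0 →
              volume (E ∩ Set.Ioo (T - h) T) ≤ ENNReal.ofReal (θ * h)) ∧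
            ∀ t ∈ Set.Ico 0 T, t ∉ E → ∀ x : EuclideanSpace ℝ (Fin 3), M ≤ ‖curl (u t) x‖ →
              κ / (T - t) ≤ ‖curl (u t) x‖ → ∃ e : EuclideanSpace ℝ (Fin 3), ‖e‖ = 1 ∧
                volume {y : EuclideanSpace ℝ (Fin 3) | lam0 * ‖curl (u t) x‖ ≤ ‖curl (u t) y‖ ∧
                    ‖x - y‖ ≤ R0 * Real.sqrt (ν / ‖curl (u t) x‖) ∧
                    ε < Real.sqrt (1 - (inner ℝ e (‖curl (u t) y‖⁻¹ • curl (u t) y)) ^ 2)}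
                  ≤ ENNReal.ofReal (δ * Real.sqrt (ν / ‖curl (u t) x‖) ^ 3)) ↔
        Summit.NavierStokesRegularity.NavierStokesRegularity.Theses.ThreadingFlux.Target)) :=
  door_iff_target_of_kill_of_regular
    (D := fun ν T u _ => ∃ lam0 : ℝ, lam0 < 1 ∧ ∃ R0 : ℝ, 0 < R0 ∧ ∃ θ : ℝ, θ < 1 ∧ ∀ κ : ℝ, 0 < κ →
      ∀ ε : ℝ, 0 < ε → ∀ δ : ℝ, 0 < δ → ∃ M : ℝ, 0 < M ∧ ∃ E : Set ℝ,
        (∃ h0 : ℝ, 0 < h0 ∧ ∀ h : ℝ, 0 < h → h < h0 →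
          volume (E ∩ Set.Ioo (T - h) T) ≤ ENNReal.ofReal (θ * h)) ∧
        ∀ t ∈ Set.Ico 0 T, t ∉ E → ∀ x : EuclideanSpace ℝ (Fin 3), M ≤ ‖curl (u t) x‖ →
          κ / (T - t) ≤ ‖curl (u t) x‖ → ∃ e : EuclideanSpace ℝ (Fin 3), ‖e‖ = 1 ∧
            volume {y : EuclideanSpace ℝ (Fin 3) | lam0 * ‖curl (u t) x‖ ≤ ‖curl (u t) y‖ ∧
                ‖x - y‖ ≤ R0 * Real.sqrt (ν / ‖curl (u t) x‖) ∧
                ε < Real.sqrt (1 - (inner ℝ e (‖curl (u t) y‖⁻¹ • curl (u t) y)) ^ 2)}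
              ≤ ENNReal.ofReal (δ * Real.sqrt (ν / ‖curl (u t) x‖) ^ 3))
    (fun _ _ hν hT _ _ hcl hLH hdec hD hI =>
      hasSmoothExtensionPast_of_mostTimesBulkAlignedExistsAnchorAt_of_typeI hν hT hcl hLH hdec hD hI)
    (fun _ _ hν hT _ _ hcl hLH hdec hext =>
      mostTimesBulkAlignedExistsAnchorAt_of_hasSmoothExtensionPast hν hT hcl hLH hdec hext)

/-- **W3ᵐᵗ-∃e ⇒ the hard core «no Type-I first blow-up»** (`ThreadingFlux.Target`, stmt-1217), BY NAME:
any proof of the re-anchored door proves the `@[hard_core]` item 1217. [folklore] -/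
theorem threadingFluxTarget_of_aprioriMostTimesBulkAlignmentExistsAnchor
    (hW : ∀ (ν T : ℝ), 0 < ν → 0 < T → ∀ (u : ℝ → EuclideanSpace ℝ (Fin 3) → EuclideanSpace ℝ (Fin 3))
      (p : ℝ → EuclideanSpace ℝ (Fin 3) → ℝ), IsClassicalNSSolutionOn (Set.Ico 0 T) ν 0 u p →
      IsLerayHopfOn T ν 0 (u 0) u → HasRapidSpatialDecay (u 0) →
      ∃ lam0 : ℝ, lam0 < 1 ∧ ∃ R0 : ℝ, 0 < R0 ∧ ∃ θ : ℝ, θ < 1 ∧ ∀ κ : ℝ, 0 < κ → ∀ ε : ℝ, 0 < ε →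
        ∀ δ : ℝ, 0 < δ → ∃ M : ℝ, 0 < M ∧ ∃ E : Set ℝ,
        (∃ h0 : ℝ, 0 < h0 ∧ ∀ h : ℝ, 0 < h → h < h0 →
          MeasureTheory.volume (E ∩ Set.Ioo (T - h) T) ≤ ENNReal.ofReal (θ * h)) ∧
        ∀ t ∈ Set.Ico 0 T, t ∉ E → ∀ x : EuclideanSpace ℝ (Fin 3), M ≤ ‖curl (u t) x‖ →
          κ / (T - t) ≤ ‖curl (u t) x‖ → ∃ e : EuclideanSpace ℝ (Fin 3), ‖e‖ = 1 ∧
            MeasureTheory.volume {y : EuclideanSpace ℝ (Fin 3) | lam0 * ‖curl (u t) x‖ ≤ ‖curl (u t) y‖ ∧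
                ‖x - y‖ ≤ R0 * Real.sqrt (ν / ‖curl (u t) x‖) ∧
                ε < Real.sqrt (1 - (inner ℝ e (‖curl (u t) y‖⁻¹ • curl (u t) y)) ^ 2)}
              ≤ ENNReal.ofReal (δ * Real.sqrt (ν / ‖curl (u t) x‖) ^ 3)) :
    Summit.NavierStokesRegularity.NavierStokesRegularity.Theses.ThreadingFlux.Target :=
  fun ν T hν hT u p hcl hLH hdec hI =>
    hasSmoothExtensionPast_of_mostTimesBulkAlignedExistsAnchorAt_of_typeI hν hT hcl hLH hdec
      (hW ν T hν hT u p hcl hLH hdec) hI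

/-! ### The certified glue one-liner with the route's own residual decl -/

/-- **Certified glue of a re-anchored route**: W3ᵐᵗ-∃e (written out, = rev21's door decl body) and the route's
residual `ScaledTopAlignment.NoTypeII` BY NAME give `NavierStokesRegularity`, in one line over the Theses-free
bridge `navierStokesRegularity_of_mostTimesBulkAlignmentExistsAnchor_of_noTypeII` — the shape of the planner's
rev21 `closes`. [folklore] -/
theorem navierStokesRegularity_of_existsAnchorDoor_of_noTypeII
    (hW : ∀ (ν T : ℝ), 0 < ν → 0 < T → ∀ (u : ℝ → EuclideanSpace ℝ (Fin 3) → EuclideanSpace ℝ (Fin 3))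
      (p : ℝ → EuclideanSpace ℝ (Fin 3) → ℝ), IsClassicalNSSolutionOn (Set.Ico 0 T) ν 0 u p →
      IsLerayHopfOn T ν 0 (u 0) u → HasRapidSpatialDecay (u 0) →
      ∃ lam0 : ℝ, lam0 < 1 ∧ ∃ R0 : ℝ, 0 < R0 ∧ ∃ θ : ℝ, θ < 1 ∧ ∀ κ : ℝ, 0 < κ → ∀ ε : ℝ, 0 < ε →
        ∀ δ : ℝ, 0 < δ → ∃ M : ℝ, 0 < M ∧ ∃ E : Set ℝ,
        (∃ h0 : ℝ, 0 < h0 ∧ ∀ h : ℝ, 0 < h → h < h0 →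
          MeasureTheory.volume (E ∩ Set.Ioo (T - h) T) ≤ ENNReal.ofReal (θ * h)) ∧
        ∀ t ∈ Set.Ico 0 T, t ∉ E → ∀ x : EuclideanSpace ℝ (Fin 3), M ≤ ‖curl (u t) x‖ →
          κ / (T - t) ≤ ‖curl (u t) x‖ → ∃ e : EuclideanSpace ℝ (Fin 3), ‖e‖ = 1 ∧
            MeasureTheory.volume {y : EuclideanSpace ℝ (Fin 3) | lam0 * ‖curl (u t) x‖ ≤ ‖curl (u t) y‖ ∧
                ‖x - y‖ ≤ R0 * Real.sqrt (ν / ‖curl (u t) x‖) ∧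
                ε < Real.sqrt (1 - (inner ℝ e (‖curl (u t) y‖⁻¹ • curl (u t) y)) ^ 2)}
              ≤ ENNReal.ofReal (δ * Real.sqrt (ν / ‖curl (u t) x‖) ^ 3))
    (hII : Summit.NavierStokesRegularity.NavierStokesRegularity.Theses.ScaledTopAlignment.NoTypeII) :
    _root_.NavierStokesRegularity :=
  navierStokesRegularity_of_mostTimesBulkAlignmentExistsAnchor_of_noTypeII hW hII

end Summit.NavierStokesRegularity.NavierStokesRegularity.Theorems

end
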